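import Summits.ValiantsHypothesis.ValiantsHypothesis.Theorems.BarrierLeverPartitionMinorsHitByVPHiddenStatesTilingExtend

/-!
# Route BarrierLever — item `PartitionMinorsHitByVP` (stmt-ValiantsHypothesis-19717), line `hidden_states`:
# ORDER-FREE «TILED CORE + FREE POINTS» THEOREM

Helper file (`--supports stmt-ValiantsHypothesis-19717`; cell valiant-natproofs, rung V4, 𝒟-side door (c); prover seat val-np-p6 gen 9).
Definition-free. Closes NO item. Sequel of `…HiddenStatesAddRow` (p601464) and `…HiddenStatesTilingExtend` (p601836).

`SymbJoin.symGood_core_free` removes the bookkeeping from `symGood_of_tiling_extend`: the rows `u : Fin r → Finset (Fin h)` (injective) and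
the columns `e` may come in ANY order. Data: injections `row, col : Fin r₀ → Fin r` pairing core columns with core rows, constant sets
`Cst p` and state relabellings `σ p` such that `u (row c)` is the shifted copy `Cst p ∪ σ p (J)` of the hidden set of column `col c`
(TILING); every non-core row is contained in no core row; every non-core column is affinely free inside its piece (cut constants `c` with
`φ_c = 1` at its hidden set and `φ_c = 0` at every other hidden set of the piece — automatic for the points of a star piece, including its
empty member). Conclusion: `symDet u e ≠ 0`, i.e. (`exists_table_of_core_free`) the `∃ tx, det ≠ 0` of the line's stubs.

Proof: enumerate the non-core columns arbitrarily and the non-core rows by non-decreasing cardinality (key `|u i|·r + i`), reindex rows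
and columns by the resulting bijections `Fin (r₀ + k) ≃ Fin r` (`symGood_of_reindex`: a reindexed symbolic determinant is `±` the
original), and apply the iterated add-row theorem with general cut constants (`symGood_extend_phi`) on top of the tiling table
(`symGood_of_tiling`). A later row of not-smaller cardinality contained in an earlier one would be equal to it, contradicting injectivity.

USE. Every «structured pieces tile a lower core u₀ ⊆ u, free points take u ∖ u₀» certificate of the cell is now ONE application of this
theorem (no cut tree, no order bookkeeping); e.g. peel(B_t([h])) ⊔ F points is good for B_t([h]) ⊔ ANY F further sets, all h.

WHAT THIS IS NOT: no claim about which cores tile which families; item 19717 OPEN; nothing on crux 14610 or VP ≠ VNP.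
-/

set_option linter.dupNamespace false

namespace Summit.ValiantsHypothesis.ValiantsHypothesis.Theorems.BarrierLever.HiddenStates

open Finset Matrix MvPolynomial

noncomputable section

namespace SymbJoin

variable {h m K r : ℕ}

/-! ## 1. Iterated add-row with general cut constants -/

/-- Iterated ADD-ROW with general cut constants: as `symGood_extend`, but a later column may be freed by any affine functional
(`φ_c = 1` at its hidden set, `φ_c = 0` at the hidden sets of the EARLIER columns of its piece), not only by a private state. -/
theorem symGood_extend_phi (r₀ : ℕ) : ∀ (k : ℕ) (u : Fin (r₀ + k) → Finset (Fin h)) (e : Fin (r₀ + k) → Fin m × Finset (Fin K)),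
    symDet (fun i : Fin r₀ => u (Fin.castAdd k i)) (fun i => e (Fin.castAdd k i)) ≠ 0 →
    (∀ i j : Fin (r₀ + k), r₀ ≤ (j : ℕ) → i < j → ¬ u j ⊆ u i) →
    (∀ j : Fin (r₀ + k), r₀ ≤ (j : ℕ) → ∃ c : Option (Fin K) → ℂ, phi c (e j).2 = 1 ∧
      ∀ i : Fin (r₀ + k), i < j → (e i).1 = (e j).1 → phi c (e i).2 = 0) →
    symDet u e ≠ 0
  | 0, u, e, h0, _, _ => by
    have hu : (fun i : Fin r₀ => u (Fin.castAdd 0 i)) = u := funext fun i => congrArg u (Fin.ext rfl)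
    have he : (fun i : Fin r₀ => e (Fin.castAdd 0 i)) = e := funext fun i => congrArg e (Fin.ext rfl)
    rwa [hu, he] at h0
  | k + 1, u, e, h0, hmax, hphi => by
    classical
    have hlast : r₀ ≤ ((Fin.last (r₀ + k) : Fin (r₀ + (k + 1))) : ℕ) := by simp
    obtain ⟨c, hc1, hc0⟩ := hphi (Fin.last (r₀ + k)) hlast
    refine symGood_addRow (r₀ := r₀ + k) u e (Fin.last (r₀ + k)) (Fin.last (r₀ + k)) c hc1 ?_ ?_ ?_
    · intro j hj
      rw [Fin.succAbove_last] at hj ⊢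
      exact hc0 _ (Fin.castSucc_lt_last j) hj
    · intro j
      rw [Fin.succAbove_last]
      exact hmax _ _ hlast (Fin.castSucc_lt_last j)
    · have IH := symGood_extend_phi r₀ k (fun i => u (Fin.castSucc i)) (fun i => e (Fin.castSucc i)) ?_ ?_ ?_
      · simpa only [Fin.succAbove_last] using IH
      · have hu : (fun i : Fin r₀ => u (Fin.castSucc (Fin.castAdd k i))) = fun i => u (Fin.castAdd (k + 1) i) :=
          funext fun i => congrArg u (castAdd_succ_eq i).symm
        have he : (fun i : Fin r₀ => e (Fin.castSucc (Fin.castAdd k i))) = fun i => e (Fin.castAdd (k + 1) i) :=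
          funext fun i => congrArg e (castAdd_succ_eq i).symm
        rw [hu, he]
        exact h0
      · intro i j hj hij
        exact hmax (Fin.castSucc i) (Fin.castSucc j) (by simpa using hj) (by simpa using hij)
      · intro j hj
        obtain ⟨c', hc'1, H⟩ := hphi (Fin.castSucc j) (by simpa using hj)
        exact ⟨c', hc'1, fun i hij hp => H (Fin.castSucc i) (by simpa using hij) hp⟩

/-! ## 2. Reindexing rows and columns -/

/-- A symbolic determinant reindexed by bijections of rows and of columns is `±` the original; in particular generic goodness transfers. -/
theorem symGood_of_reindex {n : ℕ} (u : Fin r → Finset (Fin h)) (e : Fin r → Fin m × Finset (Fin K)) (er ec : Fin n ≃ Fin r)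
    (hG : symDet (fun i => u (er i)) (fun k => e (ec k)) ≠ 0) : symDet u e ≠ 0 := by
  classical
  intro hD
  apply hG
  have hsub : symMat (fun i => u (er i)) (fun k => e (ec k)) = (symMat u e).submatrix er ec := by
    ext i k; rfl
  have hperm : (symMat u e).submatrix er ec = ((symMat u e).submatrix er er).submatrix id (ec.trans er.symm) := by
    ext i k; simp
  rw [symDet, hsub, hperm, Matrix.det_permute', Matrix.det_submatrix_equiv_self,
    show (symMat u e).det = symDet u e from rfl, hD, mul_zero]

/-! ## 3. The order-free theorem -/

/-- Elements of `Fin (r₀ + k)` below `r₀` are `castAdd`s, the others `natAdd`s. -/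
theorem eq_castAdd_or_natAdd {r₀ k : ℕ} (x : Fin (r₀ + k)) :
    (∃ i : Fin r₀, x = Fin.castAdd k i) ∨ ∃ j : Fin k, x = Fin.natAdd r₀ j := by
  by_cases hx : (x : ℕ) < r₀
  · exact Or.inl ⟨⟨x, hx⟩, Fin.ext rfl⟩
  · exact Or.inr ⟨⟨x - r₀, by omega⟩, Fin.ext (by simp; omega)⟩

/-- **ORDER-FREE «TILED CORE + FREE POINTS» THEOREM.** See the module docstring. -/
theorem symGood_core_free {r₀ : ℕ} (u : Fin r → Finset (Fin h)) (hu : Function.Injective u)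
    (e : Fin r → Fin m × Finset (Fin K)) (row col : Fin r₀ → Fin r)
    (hrow : Function.Injective row) (hcol : Function.Injective col)
    (Cst : Fin m → Finset (Fin h)) (σ : Fin m → Fin K → Fin h)
    (htile : ∀ c a, a ∈ u (row c) ↔ a ∈ Cst (e (col c)).1 ∨ ∃ q ∈ (e (col c)).2, σ (e (col c)).1 q = a)
    (hmax : ∀ i, i ∉ Set.range row → ∀ c, ¬ u i ⊆ u (row c))
    (hfree : ∀ k, k ∉ Set.range col → ∃ c : Option (Fin K) → ℂ, phi c (e k).2 = 1 ∧
      ∀ k', k' ≠ k → (e k').1 = (e k).1 → phi c (e k').2 = 0) :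
    symDet u e ≠ 0 := by
  classical
  -- sizes: r = r₀ + kk
  have hr₀ : r₀ ≤ r := by simpa using Fintype.card_le_of_injective row hrow
  obtain ⟨kk, rfl⟩ : ∃ kk, r = r₀ + kk := ⟨r - r₀, by omega⟩
  -- the non-core columns, in any order
  set Lc : Finset (Fin (r₀ + kk)) := Finset.univ \ Finset.univ.image col with hLc_def
  have hLc : Lc.card = kk := by
    rw [hLc_def, Finset.card_sdiff_of_subset (Finset.subset_univ _), Finset.card_univ, Fintype.card_fin,
      Finset.card_image_of_injective _ hcol, Finset.card_univ, Fintype.card_fin]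
    omega
  let colL : Fin kk → Fin (r₀ + kk) := fun j => Lc.orderEmbOfFin hLc j
  have hcolL_mem : ∀ j, colL j ∉ Set.range col := by
    intro j ⟨c, hc⟩
    have hm : colL j ∈ Lc := Finset.orderEmbOfFin_mem Lc hLc j
    rw [hLc_def, Finset.mem_sdiff] at hm
    exact hm.2 (Finset.mem_image.mpr ⟨c, Finset.mem_univ _, hc⟩)
  have hcolL_inj : Function.Injective colL := fun a b hab => (Lc.orderEmbOfFin hLc).injective hab
  -- the non-core rows, by non-decreasing cardinality
  set Lr : Finset (Fin (r₀ + kk)) := Finset.univ \ Finset.univ.image row with hLr_def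
  have hLr : Lr.card = kk := by
    rw [hLr_def, Finset.card_sdiff_of_subset (Finset.subset_univ _), Finset.card_univ, Fintype.card_fin,
      Finset.card_image_of_injective _ hrow, Finset.card_univ, Fintype.card_fin]
    omega
  let κ : Fin (r₀ + kk) → ℕ := fun i => (u i).card * (r₀ + kk) + (i : ℕ)
  have hκmod : ∀ i, κ i % (r₀ + kk) = (i : ℕ) := fun i => by
    simp only [κ]
    rw [Nat.mul_add_mod']
    exact Nat.mod_eq_of_lt i.2
  have hκdiv : ∀ i, κ i / (r₀ + kk) = (u i).card := fun i => by
    have hpos : 0 < r₀ + kk := Fin.pos i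
    simp only [κ]
    rw [mul_comm, Nat.mul_add_div hpos, Nat.div_eq_of_lt i.2, add_zero]
  have hκ : Function.Injective κ := fun i j hij => Fin.ext (by rw [← hκmod i, ← hκmod j, hij])
  have hLrκ : (Lr.image κ).card = kk := by rw [Finset.card_image_of_injective _ hκ, hLr]
  have hpre : ∀ j : Fin kk, ∃ i ∈ Lr, κ i = (Lr.image κ).orderEmbOfFin hLrκ j := fun j => by
    have hm := Finset.orderEmbOfFin_mem (Lr.image κ) hLrκ j
    obtain ⟨i, hi, hiκ⟩ := Finset.mem_image.mp hm
    exact ⟨i, hi, hiκ⟩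
  choose rowL hrowL_mem hrowL_κ using hpre
  have hrowL_notMem : ∀ j, rowL j ∉ Set.range row := by
    intro j ⟨c, hc⟩
    have hm := hrowL_mem j
    rw [hLr_def, Finset.mem_sdiff] at hm
    exact hm.2 (Finset.mem_image.mpr ⟨c, Finset.mem_univ _, hc⟩)
  have hrowL_lt : ∀ a b : Fin kk, a < b → κ (rowL a) < κ (rowL b) := fun a b hab => by
    rw [hrowL_κ a, hrowL_κ b]
    exact (Finset.orderEmbOfFin (Lr.image κ) hLrκ).strictMono hab
  have hrowL_inj : Function.Injective rowL := fun a b hab => by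
    by_contra hne
    rcases lt_or_gt_of_ne hne with hlt | hlt
    · exact absurd (hrowL_lt a b hlt) (by rw [hab]; exact lt_irrefl _)
    · exact absurd (hrowL_lt b a hlt) (by rw [hab]; exact lt_irrefl _)
  have hrowL_card : ∀ a b : Fin kk, a < b → (u (rowL a)).card ≤ (u (rowL b)).card := fun a b hab => by
    rw [← hκdiv (rowL a), ← hκdiv (rowL b)]
    exact Nat.div_le_div_right (le_of_lt (hrowL_lt a b hab))
  -- the reindexing bijections
  let fr : Fin (r₀ + kk) → Fin (r₀ + kk) := Fin.append row rowL
  let fc : Fin (r₀ + kk) → Fin (r₀ + kk) := Fin.append col colL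
  have hfr : Function.Injective fr :=
    Fin.append_injective_iff.mpr ⟨hrow, hrowL_inj, fun i j hij => hrowL_notMem j ⟨i, hij⟩⟩
  have hfc : Function.Injective fc :=
    Fin.append_injective_iff.mpr ⟨hcol, hcolL_inj, fun i j hij => hcolL_mem j ⟨i, hij⟩⟩
  let er : Fin (r₀ + kk) ≃ Fin (r₀ + kk) := Equiv.ofBijective fr (Finite.injective_iff_bijective.mp hfr)
  let ec : Fin (r₀ + kk) ≃ Fin (r₀ + kk) := Equiv.ofBijective fc (Finite.injective_iff_bijective.mp hfc)
  have her_l : ∀ i : Fin r₀, er (Fin.castAdd kk i) = row i := fun i => Fin.append_left row rowL i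
  have her_r : ∀ j : Fin kk, er (Fin.natAdd r₀ j) = rowL j := fun j => Fin.append_right row rowL j
  have hec_l : ∀ i : Fin r₀, ec (Fin.castAdd kk i) = col i := fun i => Fin.append_left col colL i
  have hec_r : ∀ j : Fin kk, ec (Fin.natAdd r₀ j) = colL j := fun j => Fin.append_right col colL j
  refine symGood_of_reindex u e er ec (symGood_extend_phi r₀ kk (fun i => u (er i)) (fun k => e (ec k)) ?_ ?_ ?_)
  · -- the core is tiled
    have hu' : (fun i : Fin r₀ => u (er (Fin.castAdd kk i))) = fun i => u (row i) := funext fun i => by rw [her_l]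
    have he' : (fun i : Fin r₀ => e (ec (Fin.castAdd kk i))) = fun i => e (col i) := funext fun i => by rw [hec_l]
    rw [hu', he']
    exact symGood_of_tiling (fun i => u (row i)) (hu.comp hrow) (fun i => e (col i)) Cst σ htile
  · -- later rows are contained in no earlier row
    intro i j hj hij hsub
    rcases eq_castAdd_or_natAdd j with ⟨j', rfl⟩ | ⟨j', rfl⟩
    · simp at hj; omega
    rw [her_r] at hsub
    rcases eq_castAdd_or_natAdd i with ⟨i', rfl⟩ | ⟨i', rfl⟩
    · rw [her_l] at hsub
      exact hmax (rowL j') (hrowL_notMem j') i' hsub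
    · rw [her_r] at hsub
      have hlt : i' < j' := by
        have : ((Fin.natAdd r₀ i' : Fin (r₀ + kk)) : ℕ) < (Fin.natAdd r₀ j' : Fin (r₀ + kk)) := hij
        simp at this
        exact this
      have hcard := hrowL_card i' j' hlt
      have heq : u (rowL j') = u (rowL i') := Finset.eq_of_subset_of_card_le hsub hcard
      exact absurd (hrowL_inj (hu heq)) (ne_of_gt hlt)
  · -- later columns are affinely free inside their pieces
    intro j hj
    rcases eq_castAdd_or_natAdd j with ⟨j', rfl⟩ | ⟨j', rfl⟩
    · simp at hj; omega
    obtain ⟨c, hc1, hc0⟩ := hfree (ec (Fin.natAdd r₀ j')) (by rw [hec_r]; exact hcolL_mem j')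
    exact ⟨c, hc1, fun i hij hp => hc0 (ec i) (fun heq => absurd (ec.injective heq) (ne_of_lt hij)) hp⟩

/-- The numeric form (`∃ tx, det ≠ 0`) of `symGood_core_free`. -/
theorem exists_table_of_core_free {r₀ : ℕ} (u : Fin r → Finset (Fin h)) (hu : Function.Injective u)
    (e : Fin r → Fin m × Finset (Fin K)) (row col : Fin r₀ → Fin r)
    (hrow : Function.Injective row) (hcol : Function.Injective col)
    (Cst : Fin m → Finset (Fin h)) (σ : Fin m → Fin K → Fin h)
    (htile : ∀ c a, a ∈ u (row c) ↔ a ∈ Cst (e (col c)).1 ∨ ∃ q ∈ (e (col c)).2, σ (e (col c)).1 q = a)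
    (hmax : ∀ i, i ∉ Set.range row → ∀ c, ¬ u i ⊆ u (row c))
    (hfree : ∀ k, k ∉ Set.range col → ∃ c : Option (Fin K) → ℂ, phi c (e k).2 = 1 ∧
      ∀ k', k' ≠ k → (e k').1 = (e k).1 → phi c (e k').2 = 0) :
    ∃ tx : Fin m → Option (Fin K) → Fin h → ℂ,
      (Matrix.of fun i k : Fin r =>
        ∏ a ∈ u i, (tx (e k).1 none a + ∑ q ∈ (e k).2, tx (e k).1 (some q) a)).det ≠ 0 :=
  exists_table_of_symGood u e (symGood_core_free u hu e row col hrow hcol Cst σ htile hmax hfree)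

end SymbJoin

end

end Summit.ValiantsHypothesis.ValiantsHypothesis.Theorems.BarrierLever.HiddenStates
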